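import Summits.CriticalPhenomena.PercolationContinuityZ3.Theorems.PercNearOneGluingAdditiveGluingTwoStepGlue
import HarnessLib

/-!
# Crux `PercNearOneGluing.AdditiveGluing` (stmt-CriticalPhenomena-4576): the second kernel (V3″) of the two-step gluing reduction

Support file (`--supports stmt-CriticalPhenomena-4576`; task png-dp-al5, memo TWOSTEP-GLUE.md).  No definitions, no named facts, no sorries.
Notation of `…TwoStepGlue.lean`: glued pair `{a₁,a₂}`, spectator `c`, `θ ≤ τ_{a₁}, τ_{a₂}`, `N = {c↮a₁} ∩ {c↮a₂}`,
`G_x = μ((x↔b)ᶜ ∩ (x↔a₁ ∪ x↔a₂) ∩ (a₁↔b ∪ a₂↔b))`, `ROOM₁ = μ(oAᶜ ∩ (a₁↔b ∪ a₂↔b) ∩ (c↔b)ᶜ ∩ N)`.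

The weighted Kozma–Nitzan Theorem 1 used in `twoStep_cag3` is the sum of two ONE-SIDED inequalities ("BHK twice" each); the one for the
spectator's side alone (`twoStep_thm1_half`) gives, through the same chain, CAG(3) from

  (V3″)  `μ(N)·(G_o − G_c − ROOM₁ − (τ_c − θ)) ≤ μ(N ∩ (o↔a₁ ∪ o↔a₂))·(μ(a₁↔b ∪ a₂↔b) − τ_c − G_c)`,

i.e. `G_o ≤ G_c + ROOM₁ + (τ_c − θ) + φ₁₂·(Gain¹(c))` with `φ₁₂ = μ(o ↔ {a₁,a₂} | c ↮ {a₁,a₂})`: the observer out-gains the spectator by at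
most the room plus `φ₁₂` times the spectator's own gain from the second gluing — "Kozma–Nitzan Lemma 4 relative to a spectator".
At a full tie (`θ = τ_c = τ_{a₁} = τ_{a₂}`) this reads `G_o − G_c ≤ ROOM₁ + φ₁₂·(π − G_c)`; numerically 0 violations (memo §2, lab/t23).
* `twoStep_thm1_half` — `μ(D)·(μE − μF_y) ≥ μ(D ∩ o↔x)·(μ(D ∩ x↔b) − μ(D ∩ y↔b))` (half of the weighted Theorem 1);
* `twoStep_glue_N`, `twoStep_glue_NB12`, `twoStep_glue_NBc` — pull-backs; * `twoStep_cag3_of_v3pp`, `twoStep_threeRelays_eform_of_v3pp`.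
[cite: KozmaNitzan2024, Theorem 1 (pp. 7–8), Lemma 4 (p. 9), Question 7 (p. 36)] [cite: VandenbergHaggstromKahn2005, Thms. 1.3–1.4]
-/

namespace Summit.CriticalPhenomena.PercolationContinuityZ3.Theorems

open MeasureTheory Set Literature.Probability.LatticeModels Literature.Probability.Percolation

noncomputable section
open Classical

variable {n : ℕ}

/-- **Half of the weighted Theorem 1** ("BHK twice"): for relays `x ≠ y`, `D = {x ↮ y}`, `E = o↔b ∩ (o↔x ∪ o↔y)`,
`F_y = (o↔x ∪ o↔y) ∩ y↔b`:  `μ(D)·(μE − μF_y) ≥ μ(D ∩ o↔x)·(μ(D ∩ x↔b) − μ(D ∩ y↔b))`.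
[cite: KozmaNitzan2024, Theorem 1 (pp. 7–8)] [cite: VandenbergHaggstromKahn2005, Thms. 1.3–1.4] -/
theorem twoStep_thm1_half (u : Sym2 (Fin n) → unitInterval) (o b x y : Fin n) (hxy : x ≠ y) :
    (prodBernoulli u).real ((openConn x y)ᶜ ∩ openConn o x) *
        ((prodBernoulli u).real ((openConn x y)ᶜ ∩ openConn x b) - (prodBernoulli u).real ((openConn x y)ᶜ ∩ openConn y b)) ≤
      (prodBernoulli u).real (openConn x y)ᶜ *
        ((prodBernoulli u).real (openConn o b ∩ (openConn o x ∪ openConn o y)) -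
          (prodBernoulli u).real ((openConn o x ∪ openConn o y) ∩ openConn y b)) := by
  set μ := prodBernoulli u with hμ
  set O₁ : Set (BondConfig (Fin n)) := openConn o x with hO₁
  set O₂ : Set (BondConfig (Fin n)) := openConn o y with hO₂
  set Ob : Set (BondConfig (Fin n)) := openConn o b with hOb
  set B₁ : Set (BondConfig (Fin n)) := openConn x b with hB₁
  set B₂ : Set (BondConfig (Fin n)) := openConn y b with hB₂
  set D : Set (BondConfig (Fin n)) := {ω | ¬ (openGraph ω).Reachable x y} with hD
  set E : Set (BondConfig (Fin n)) := Ob ∩ (O₁ ∪ O₂) with hE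
  set F₂ : Set (BondConfig (Fin n)) := (O₁ ∪ O₂) ∩ B₂ with hF₂
  have hDc : ((openConn x y)ᶜ : Set (BondConfig (Fin n))) = D := by
    ext ω
    simp only [mem_compl_iff, openConn, mem_setOf_eq, hD]
  rw [hDc]
  have hsplit : ∀ A S : Set (BondConfig (Fin n)), μ.real A = μ.real (A ∩ S) + μ.real (A ∩ Sᶜ) := by
    intro A S
    rw [← measureReal_inter_add_sdiff (s := A) (MeasurableSet.of_discrete : MeasurableSet S), Set.sdiff_eq]
  have hE2 : E ∩ O₂ = F₂ ∩ O₂ := by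
    ext ω
    simp only [mem_inter_iff, mem_union, hE, hF₂, hO₁, hO₂, hOb, hB₂, openConn, mem_setOf_eq]
    constructor
    · rintro ⟨⟨hb, _⟩, h2⟩
      exact ⟨⟨Or.inr h2, h2.symm.trans hb⟩, h2⟩
    · rintro ⟨⟨_, hb⟩, h2⟩
      exact ⟨⟨h2.trans hb, Or.inr h2⟩, h2⟩
  have hE2c : E ∩ O₂ᶜ = O₁ ∩ B₁ ∩ D := by
    ext ω
    simp only [mem_inter_iff, mem_union, mem_compl_iff, hE, hO₁, hO₂, hOb, hB₁, hD, openConn, mem_setOf_eq]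
    constructor
    · rintro ⟨⟨hb, h1 | h2⟩, hn2⟩
      · exact ⟨⟨h1, h1.symm.trans hb⟩, fun h => hn2 (h1.trans h)⟩
      · exact absurd h2 hn2
    · rintro ⟨⟨h1, hb⟩, hn⟩
      exact ⟨⟨h1.trans hb, Or.inl h1⟩, fun h2 => hn (h1.symm.trans h2)⟩
  have hF2c : F₂ ∩ O₂ᶜ = O₁ ∩ B₂ ∩ D := by
    ext ω
    simp only [mem_inter_iff, mem_union, mem_compl_iff, hF₂, hO₁, hO₂, hB₂, hD, openConn, mem_setOf_eq]
    constructor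
    · rintro ⟨⟨h1 | h2, hb⟩, hn2⟩
      · exact ⟨⟨h1, hb⟩, fun h => hn2 (h1.trans h)⟩
      · exact absurd h2 hn2
    · rintro ⟨⟨h1, hb⟩, hn⟩
      exact ⟨⟨Or.inl h1, hb⟩, fun h2 => hn (h1.symm.trans h2)⟩
  have hdiff2 : μ.real E - μ.real F₂ = μ.real (O₁ ∩ B₁ ∩ D) - μ.real (O₁ ∩ B₂ ∩ D) := by
    rw [hsplit E O₂, hsplit F₂ O₂, hE2, hE2c, hF2c]
    ring
  have hD1 : {ω : BondConfig (Fin n) | ∀ z ∈ ({y} : Set (Fin n)), ¬ (openGraph ω).Reachable x z} = D := by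
    ext ω
    simp [hD]
  have h_iii := KNPreFKG.bhk_one_upper_upper u x ({y} : Set (Fin n)) (by simpa using hxy)
    (KNPreFKG.isUpperSet_connFamily x o) (KNPreFKG.isUpperSet_connFamily x b)
  rw [hD1, ← KNPreFKG.openConn_eq_setOf_connFamily, ← KNPreFKG.openConn_eq_setOf_connFamily,
    KNPreFKG.openConn_symm x o] at h_iii
  have h_iv := KNPreFKG.bhk_two_upper_upper u x y hxy (KNPreFKG.isUpperSet_connFamily x o)
    (KNPreFKG.isUpperSet_connFamily y b)
  rw [← KNPreFKG.openConn_eq_setOf_connFamily, ← KNPreFKG.openConn_eq_setOf_connFamily,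
    KNPreFKG.openConn_symm x o] at h_iv
  have e3 : D ∩ (O₁ ∩ B₁) = O₁ ∩ B₁ ∩ D := inter_comm _ _
  have e4 : D ∩ (O₁ ∩ B₂) = O₁ ∩ B₂ ∩ D := inter_comm _ _
  simp only [← hD, ← hO₁, ← hB₁, ← hB₂] at h_iii h_iv
  rw [e3] at h_iii
  rw [e4] at h_iv
  rw [hdiff2, mul_sub, mul_sub]
  nlinarith [h_iii, h_iv]

/-! ### More pull-backs along the glued pair -/

/-- `μ¹({a₁ ↮ c}) = μ(N)`. [folklore] -/
theorem twoStep_glue_N (w : Sym2 (Fin n) → unitInterval) {a₁ a₂ : Fin n} (h12 : a₁ ≠ a₂) (c : Fin n) :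
    (prodBernoulli (Function.update w s(a₁, a₂) 1)).real (openConn a₁ c)ᶜ =
      (prodBernoulli w).real ((openConn c a₁)ᶜ ∩ (openConn c a₂)ᶜ : Set (BondConfig (Fin n))) := by
  rw [fullTie_real_update_one w h12]
  congr 1
  ext ω
  simp only [Set.mem_setOf_eq, Set.mem_inter_iff, Set.mem_compl_iff, twoStep_glueReach_left]
  have hs1 : ω ∈ (openConn a₁ c : Set (BondConfig (Fin n))) ↔ ω ∈ (openConn c a₁ : Set (BondConfig (Fin n))) :=
    ⟨fun h => SimpleGraph.Reachable.symm h, fun h => SimpleGraph.Reachable.symm h⟩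
  have hs2 : ω ∈ (openConn a₂ c : Set (BondConfig (Fin n))) ↔ ω ∈ (openConn c a₂ : Set (BondConfig (Fin n))) :=
    ⟨fun h => SimpleGraph.Reachable.symm h, fun h => SimpleGraph.Reachable.symm h⟩
  tauto

/-- `μ¹({a₁ ↮ c} ∩ a₁↔b) = μ(N ∩ (a₁↔b ∪ a₂↔b))`. [folklore] -/
theorem twoStep_glue_NB12 (w : Sym2 (Fin n) → unitInterval) {a₁ a₂ : Fin n} (h12 : a₁ ≠ a₂) (b c : Fin n) :
    (prodBernoulli (Function.update w s(a₁, a₂) 1)).real ((openConn a₁ c)ᶜ ∩ openConn a₁ b) =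
      (prodBernoulli w).real ((openConn c a₁)ᶜ ∩ (openConn c a₂)ᶜ ∩ (openConn a₁ b ∪ openConn a₂ b) :
        Set (BondConfig (Fin n))) := by
  rw [fullTie_real_update_one w h12]
  congr 1
  ext ω
  simp only [Set.mem_setOf_eq, Set.mem_inter_iff, Set.mem_compl_iff, Set.mem_union, twoStep_glueReach_left]
  have hs1 : ω ∈ (openConn a₁ c : Set (BondConfig (Fin n))) ↔ ω ∈ (openConn c a₁ : Set (BondConfig (Fin n))) :=
    ⟨fun h => SimpleGraph.Reachable.symm h, fun h => SimpleGraph.Reachable.symm h⟩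
  have hs2 : ω ∈ (openConn a₂ c : Set (BondConfig (Fin n))) ↔ ω ∈ (openConn c a₂ : Set (BondConfig (Fin n))) :=
    ⟨fun h => SimpleGraph.Reachable.symm h, fun h => SimpleGraph.Reachable.symm h⟩
  tauto

/-- `μ¹({a₁ ↮ c} ∩ c↔b) = μ(N ∩ c↔b)`. [folklore] -/
theorem twoStep_glue_NBc (w : Sym2 (Fin n) → unitInterval) {a₁ a₂ : Fin n} (h12 : a₁ ≠ a₂) (b c : Fin n) :
    (prodBernoulli (Function.update w s(a₁, a₂) 1)).real ((openConn a₁ c)ᶜ ∩ openConn c b) =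
      (prodBernoulli w).real ((openConn c a₁)ᶜ ∩ (openConn c a₂)ᶜ ∩ openConn c b : Set (BondConfig (Fin n))) := by
  rw [fullTie_real_update_one w h12]
  congr 1
  ext ω
  simp only [Set.mem_setOf_eq, Set.mem_inter_iff, Set.mem_compl_iff, twoStep_glueReach_left]
  rw [fullTie_glueReach_pair]
  have hs1 : ω ∈ (openConn a₁ c : Set (BondConfig (Fin n))) ↔ ω ∈ (openConn c a₁ : Set (BondConfig (Fin n))) :=
    ⟨fun h => SimpleGraph.Reachable.symm h, fun h => SimpleGraph.Reachable.symm h⟩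
  have hs2 : ω ∈ (openConn a₂ c : Set (BondConfig (Fin n))) ↔ ω ∈ (openConn c a₂ : Set (BondConfig (Fin n))) :=
    ⟨fun h => SimpleGraph.Reachable.symm h, fun h => SimpleGraph.Reachable.symm h⟩
  tauto

/-! ### CAG(3) from (V3″) -/

/-- **CAG(3) from (V3″)** (see the file header).  Hypotheses: `a₁ ≠ a₂`, `a₁ ≠ c`, `θ ≤ τ_{a₁}, τ_{a₂}` and the denominator-free
form of (V3″): `μ(N)·(G_o − G_c − ROOM₁ − (τ_c − θ)) ≤ μ(N ∩ (o↔a₁ ∪ o↔a₂))·(μ(a₁↔b ∪ a₂↔b) − τ_c − G_c)`.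
[cite: KozmaNitzan2024, Theorem 1 (pp. 7–8), Lemma 4 (p. 9), Question 7 (p. 36)] -/
theorem twoStep_cag3_of_v3pp (w : Sym2 (Fin n) → unitInterval) (o b a₁ a₂ c : Fin n) (h12 : a₁ ≠ a₂) (h1c : a₁ ≠ c)
    (θ : ℝ) (hθ1 : θ ≤ (prodBernoulli w).real (openConn a₁ b)) (hθ2 : θ ≤ (prodBernoulli w).real (openConn a₂ b))
    (hV : (prodBernoulli w).real ((openConn c a₁)ᶜ ∩ (openConn c a₂)ᶜ : Set (BondConfig (Fin n))) *
        ((prodBernoulli w).real ((openConn o b)ᶜ ∩ (openConn o a₁ ∪ openConn o a₂) ∩ (openConn a₁ b ∪ openConn a₂ b)) -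
          (prodBernoulli w).real ((openConn c b)ᶜ ∩ (openConn c a₁ ∪ openConn c a₂) ∩ (openConn a₁ b ∪ openConn a₂ b)) -
          (prodBernoulli w).real ((openConn o a₁ ∪ openConn o a₂ ∪ openConn o c)ᶜ ∩ (openConn a₁ b ∪ openConn a₂ b) ∩
            (openConn c b)ᶜ ∩ ((openConn c a₁)ᶜ ∩ (openConn c a₂)ᶜ)) -
          ((prodBernoulli w).real (openConn c b) - θ)) ≤
      (prodBernoulli w).real ((openConn c a₁)ᶜ ∩ (openConn c a₂)ᶜ ∩ (openConn o a₁ ∪ openConn o a₂)) *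
        ((prodBernoulli w).real (openConn a₁ b ∪ openConn a₂ b) - (prodBernoulli w).real (openConn c b) -
          (prodBernoulli w).real ((openConn c b)ᶜ ∩ (openConn c a₁ ∪ openConn c a₂) ∩ (openConn a₁ b ∪ openConn a₂ b)))) :
    (prodBernoulli w).real ((openConn o a₁ ∪ openConn o a₂ ∪ openConn o c) ∩ (openConn o b)ᶜ ∩
        (openConn a₁ b ∪ openConn a₂ b ∪ openConn c b)) ≤
      (prodBernoulli w).real (openConn a₁ b ∪ openConn a₂ b ∪ openConn c b) - θ := by
  set μ := prodBernoulli w with hμ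
  have hm : ∀ s : Set (BondConfig (Fin n)), MeasurableSet s := fun _ => MeasurableSet.of_discrete
  set O₁ : Set (BondConfig (Fin n)) := openConn o a₁ with hO₁
  set O₂ : Set (BondConfig (Fin n)) := openConn o a₂ with hO₂
  set Oc : Set (BondConfig (Fin n)) := openConn o c with hOc
  set Ob : Set (BondConfig (Fin n)) := openConn o b with hOb
  set B₁ : Set (BondConfig (Fin n)) := openConn a₁ b with hB₁
  set B₂ : Set (BondConfig (Fin n)) := openConn a₂ b with hB₂
  set Bc : Set (BondConfig (Fin n)) := openConn c b with hBc
  set C₁ : Set (BondConfig (Fin n)) := openConn c a₁ with hC₁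
  set C₂ : Set (BondConfig (Fin n)) := openConn c a₂ with hC₂
  -- half Theorem 1 in the glued weighting (relays x = a₁, y = c), EF identity, pull-backs
  have hH := twoStep_thm1_half (Function.update w s(a₁, a₂) 1) o b a₁ c h1c
  have hE2 := twoStep_EF_identity (Function.update w s(a₁, a₂) 1) o b c a₁
  have hu1 : (openConn o c ∪ openConn o a₁ : Set (BondConfig (Fin n))) = openConn o a₁ ∪ openConn o c :=
    Set.union_comm _ _
  have hu2 : (openConn c b ∪ openConn a₁ b : Set (BondConfig (Fin n))) = openConn a₁ b ∪ openConn c b :=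
    Set.union_comm _ _
  rw [hu1, hu2] at hE2
  rw [hE2, twoStep_glue_psi12 w h12 o c, twoStep_glue_N w h12 c, twoStep_glue_NB12 w h12 b c, twoStep_glue_NBc w h12 b c,
    twoStep_glue_gain w h12 o b c, twoStep_glue_Ta w h12 o b c] at hH
  simp only [← hμ, ← hO₁, ← hO₂, ← hOc, ← hOb, ← hB₁, ← hB₂, ← hBc, ← hC₁, ← hC₂] at hH hV ⊢
  -- identities in `w`
  have hd1 : μ.real ((O₁ ∪ O₂ ∪ Oc) ∩ Obᶜ ∩ (B₁ ∪ B₂ ∪ Bc)) =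
      μ.real (Obᶜ ∩ (O₁ ∪ O₂) ∩ (B₁ ∪ B₂)) +
        μ.real ((O₁ ∪ O₂ ∪ Oc) ∩ Obᶜ ∩ ((O₁ ∪ O₂) ∩ (B₁ ∪ B₂))ᶜ ∩ (B₁ ∪ B₂ ∪ Bc)) := by
    have h := measureReal_inter_add_sdiff (μ := μ) (s := (O₁ ∪ O₂ ∪ Oc) ∩ Obᶜ ∩ (B₁ ∪ B₂ ∪ Bc))
      (hm ((O₁ ∪ O₂) ∩ (B₁ ∪ B₂)))
    have e1 : (O₁ ∪ O₂ ∪ Oc) ∩ Obᶜ ∩ (B₁ ∪ B₂ ∪ Bc) ∩ ((O₁ ∪ O₂) ∩ (B₁ ∪ B₂)) =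
        Obᶜ ∩ (O₁ ∪ O₂) ∩ (B₁ ∪ B₂) := by
      ext ω; simp only [Set.mem_inter_iff, Set.mem_union, Set.mem_compl_iff]; tauto
    have e2 : ((O₁ ∪ O₂ ∪ Oc) ∩ Obᶜ ∩ (B₁ ∪ B₂ ∪ Bc)) \ ((O₁ ∪ O₂) ∩ (B₁ ∪ B₂)) =
        (O₁ ∪ O₂ ∪ Oc) ∩ Obᶜ ∩ ((O₁ ∪ O₂) ∩ (B₁ ∪ B₂))ᶜ ∩ (B₁ ∪ B₂ ∪ Bc) := by
      ext ω; simp only [Set.mem_sdiff, Set.mem_inter_iff, Set.mem_compl_iff]; tauto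
    rw [e1, e2] at h
    linarith
  have hd3 : μ.real ((O₁ ∪ O₂ ∪ Oc) ∩ (B₁ ∪ B₂) ∩ Bcᶜ ∩ (C₁ᶜ ∩ C₂ᶜ)) =
      μ.real (B₁ ∪ B₂ ∪ Bc) - μ.real Bc - μ.real (Bcᶜ ∩ (C₁ ∪ C₂) ∩ (B₁ ∪ B₂)) -
        μ.real ((O₁ ∪ O₂ ∪ Oc)ᶜ ∩ (B₁ ∪ B₂) ∩ Bcᶜ ∩ (C₁ᶜ ∩ C₂ᶜ)) := by
    have h := measureReal_inter_add_sdiff (μ := μ) (s := B₁ ∪ B₂ ∪ Bc) (hm Bc)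
    have e1 : (B₁ ∪ B₂ ∪ Bc) ∩ Bc = Bc := Set.inter_eq_right.2 Set.subset_union_right
    have e2 : (B₁ ∪ B₂ ∪ Bc) \ Bc = (B₁ ∪ B₂) ∩ Bcᶜ := by
      ext ω; simp only [Set.mem_sdiff, Set.mem_inter_iff, Set.mem_union, Set.mem_compl_iff]; tauto
    rw [e1, e2] at h
    have h' := measureReal_inter_add_sdiff (μ := μ) (s := (B₁ ∪ B₂) ∩ Bcᶜ) (hm (C₁ᶜ ∩ C₂ᶜ))
    have e4 : ((B₁ ∪ B₂) ∩ Bcᶜ) \ (C₁ᶜ ∩ C₂ᶜ) = Bcᶜ ∩ (C₁ ∪ C₂) ∩ (B₁ ∪ B₂) := by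
      ext ω; simp only [Set.mem_sdiff, Set.mem_inter_iff, Set.mem_union, Set.mem_compl_iff]; tauto
    rw [e4] at h'
    have h'' := measureReal_inter_add_sdiff (μ := μ) (s := (B₁ ∪ B₂) ∩ Bcᶜ ∩ (C₁ᶜ ∩ C₂ᶜ)) (hm (O₁ ∪ O₂ ∪ Oc))
    have e5 : (B₁ ∪ B₂) ∩ Bcᶜ ∩ (C₁ᶜ ∩ C₂ᶜ) ∩ (O₁ ∪ O₂ ∪ Oc) =
        (O₁ ∪ O₂ ∪ Oc) ∩ (B₁ ∪ B₂) ∩ Bcᶜ ∩ (C₁ᶜ ∩ C₂ᶜ) := by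
      ext ω; simp only [Set.mem_inter_iff]; tauto
    have e6 : ((B₁ ∪ B₂) ∩ Bcᶜ ∩ (C₁ᶜ ∩ C₂ᶜ)) \ (O₁ ∪ O₂ ∪ Oc) =
        (O₁ ∪ O₂ ∪ Oc)ᶜ ∩ (B₁ ∪ B₂) ∩ Bcᶜ ∩ (C₁ᶜ ∩ C₂ᶜ) := by
      ext ω; simp only [Set.mem_sdiff, Set.mem_inter_iff, Set.mem_compl_iff]; tauto
    rw [e5, e6] at h''
    linarith
  -- `μ(N ∩ B₁₂) − μ(N ∩ Bc) = μ(B₁₂) − τ_c − G_c`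
  have hd4 : μ.real (C₁ᶜ ∩ C₂ᶜ ∩ (B₁ ∪ B₂)) - μ.real (C₁ᶜ ∩ C₂ᶜ ∩ Bc) =
      μ.real (B₁ ∪ B₂) - μ.real Bc - μ.real (Bcᶜ ∩ (C₁ ∪ C₂) ∩ (B₁ ∪ B₂)) := by
    have h1 := measureReal_inter_add_sdiff (μ := μ) (s := B₁ ∪ B₂) (hm (C₁ᶜ ∩ C₂ᶜ))
    have h2 := measureReal_inter_add_sdiff (μ := μ) (s := Bc) (hm (C₁ᶜ ∩ C₂ᶜ))
    have h3 := measureReal_inter_add_sdiff (μ := μ) (s := (B₁ ∪ B₂) \ (C₁ᶜ ∩ C₂ᶜ)) (hm Bc)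
    have e1 : (B₁ ∪ B₂) ∩ (C₁ᶜ ∩ C₂ᶜ) = C₁ᶜ ∩ C₂ᶜ ∩ (B₁ ∪ B₂) := Set.inter_comm _ _
    have e2 : Bc ∩ (C₁ᶜ ∩ C₂ᶜ) = C₁ᶜ ∩ C₂ᶜ ∩ Bc := Set.inter_comm _ _
    -- on `Nᶜ` (c joined to the pair), `c↔b ⊆ a₁↔b ∪ a₂↔b`
    have e3 : ((B₁ ∪ B₂) \ (C₁ᶜ ∩ C₂ᶜ)) ∩ Bc = Bc \ (C₁ᶜ ∩ C₂ᶜ) := by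
      ext ω
      simp only [Set.mem_inter_iff, Set.mem_sdiff, Set.mem_union, Set.mem_compl_iff, hB₁, hB₂, hBc, hC₁, hC₂, openConn,
        Set.mem_setOf_eq, not_and, not_not]
      constructor
      · rintro ⟨⟨_, hN⟩, hcb⟩; exact ⟨hcb, hN⟩
      · rintro ⟨hcb, hN⟩
        refine ⟨⟨?_, hN⟩, hcb⟩
        by_cases h1 : (openGraph ω).Reachable c a₁
        · exact Or.inl (h1.symm.trans hcb)
        · exact Or.inr ((hN h1).symm.trans hcb)
    have e4 : ((B₁ ∪ B₂) \ (C₁ᶜ ∩ C₂ᶜ)) \ Bc = Bcᶜ ∩ (C₁ ∪ C₂) ∩ (B₁ ∪ B₂) := by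
      ext ω; simp only [Set.mem_sdiff, Set.mem_inter_iff, Set.mem_union, Set.mem_compl_iff]; tauto
    rw [e1] at h1
    rw [e2] at h2
    rw [e3, e4] at h3
    linarith
  -- Kozma–Nitzan Lemma 4 for the degenerate case
  have hL4 := knLemma4_pair w o a₁ a₂ b
  simp only [← hμ, ← hO₁, ← hO₂, ← hOb, ← hB₁, ← hB₂] at hL4
  have hmin : θ ≤ min (μ.real B₁) (μ.real B₂) := le_min hθ1 hθ2
  have hmono : μ.real (B₁ ∪ B₂) ≤ μ.real (B₁ ∪ B₂ ∪ Bc) := measureReal_mono Set.subset_union_left (measure_ne_top _ _)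
  -- the glued gain event lies in `N`
  have hGGsub : (O₁ ∪ O₂ ∪ Oc) ∩ Obᶜ ∩ ((O₁ ∪ O₂) ∩ (B₁ ∪ B₂))ᶜ ∩ (B₁ ∪ B₂ ∪ Bc) ⊆ C₁ᶜ ∩ C₂ᶜ := by
    intro ω hω
    rcases hω with ⟨⟨⟨hO, -⟩, hnX⟩, hB⟩
    simp only [Set.mem_union, Set.mem_inter_iff, Set.mem_compl_iff, not_and, not_or] at hO hB hnX ⊢
    have hnb : (ω ∈ O₁ ∨ ω ∈ O₂) → ω ∉ B₁ ∧ ω ∉ B₂ := fun h => hnX h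
    constructor
    · intro hc1
      have hO12 : ω ∈ O₁ ∨ ω ∈ O₂ := by
        rcases hO with h | hc
        · exact h
        · exact Or.inl (SimpleGraph.Reachable.trans hc hc1)
      have hnb' := hnb hO12
      rcases hB with (hb1 | hb2) | hbc
      · exact hnb'.1 hb1
      · exact hnb'.2 hb2
      · exact hnb'.1 (SimpleGraph.Reachable.trans (SimpleGraph.Reachable.symm hc1) hbc)
    · intro hc2
      have hO12 : ω ∈ O₁ ∨ ω ∈ O₂ := by
        rcases hO with h | hc
        · exact h
        · exact Or.inr (SimpleGraph.Reachable.trans hc hc2)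
      have hnb' := hnb hO12
      rcases hB with (hb1 | hb2) | hbc
      · exact hnb'.1 hb1
      · exact hnb'.2 hb2
      · exact hnb'.2 (SimpleGraph.Reachable.trans (SimpleGraph.Reachable.symm hc2) hbc)
  have hGGle : μ.real ((O₁ ∪ O₂ ∪ Oc) ∩ Obᶜ ∩ ((O₁ ∪ O₂) ∩ (B₁ ∪ B₂))ᶜ ∩ (B₁ ∪ B₂ ∪ Bc)) ≤ μ.real (C₁ᶜ ∩ C₂ᶜ) :=
    measureReal_mono hGGsub (measure_ne_top _ _)
  rw [hd1]
  by_cases hN0 : μ.real (C₁ᶜ ∩ C₂ᶜ) = 0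
  · have hGG0 : μ.real ((O₁ ∪ O₂ ∪ Oc) ∩ Obᶜ ∩ ((O₁ ∪ O₂) ∩ (B₁ ∪ B₂))ᶜ ∩ (B₁ ∪ B₂ ∪ Bc)) = 0 :=
      le_antisymm (hN0 ▸ hGGle) measureReal_nonneg
    rw [hGG0]
    linarith
  · have hNpos : 0 < μ.real (C₁ᶜ ∩ C₂ᶜ) := lt_of_le_of_ne measureReal_nonneg (Ne.symm hN0)
    rw [hd3, hd4] at hH
    -- `μ(N)·(GG − T_a) ≤ −ψ₁₂·δ'`, and (V3″): combine and divide by `μ(N)`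
    have key : μ.real (C₁ᶜ ∩ C₂ᶜ) *
        (μ.real (Obᶜ ∩ (O₁ ∪ O₂) ∩ (B₁ ∪ B₂)) +
          μ.real ((O₁ ∪ O₂ ∪ Oc) ∩ Obᶜ ∩ ((O₁ ∪ O₂) ∩ (B₁ ∪ B₂))ᶜ ∩ (B₁ ∪ B₂ ∪ Bc)) + θ -
          μ.real (B₁ ∪ B₂ ∪ Bc)) ≤ 0 := by
      nlinarith [hH, hV]
    have key2 : μ.real (Obᶜ ∩ (O₁ ∪ O₂) ∩ (B₁ ∪ B₂)) +
        μ.real ((O₁ ∪ O₂ ∪ Oc) ∩ Obᶜ ∩ ((O₁ ∪ O₂) ∩ (B₁ ∪ B₂))ᶜ ∩ (B₁ ∪ B₂ ∪ Bc)) + θ -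
        μ.real (B₁ ∪ B₂ ∪ Bc) ≤ 0 := by
      by_contra hc
      have hc' : 0 < μ.real (Obᶜ ∩ (O₁ ∪ O₂) ∩ (B₁ ∪ B₂)) +
          μ.real ((O₁ ∪ O₂ ∪ Oc) ∩ Obᶜ ∩ ((O₁ ∪ O₂) ∩ (B₁ ∪ B₂))ᶜ ∩ (B₁ ∪ B₂ ∪ Bc)) + θ -
          μ.real (B₁ ∪ B₂ ∪ Bc) := lt_of_not_ge hc
      have := mul_pos hNpos hc'
      linarith
    linarith

end

end Summit.CriticalPhenomena.PercolationContinuityZ3.Theorems
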